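import Literature.Barriers.FinalStateConjecture.NonSmoothNullInfinityExistence
import Mathlib.Analysis.SpecialFunctions.Log.Basic
import Mathlib.Analysis.SpecialFunctions.Pow.Asymptotics
import Mathlib.Analysis.Complex.ExponentialBounds
import HarnessLib

/-!
# Barrier catalogue `FinalStateConjecture`: the early-time region `{u ≤ U₀}` of the Schwarzschild
# exterior — geometry of the area radius and the integration rules used in the decay estimates
(`Literature/Barriers/FinalStateConjecture/`; namespace `Literature.Barriers.FinalStateConjecture`)

Kehrberger's estimates (arXiv:2105.08079, §4 and §6) live in the region
`𝒟_{U₀} = {u ≤ U₀, v ≥ v₂}` "for sufficiently large negative values of `U₀`", where the EF area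
radius `r(u, v)` is comparable with `|u| = −u` and, on the data strip `v ∈ [v₁, v₂]`, equals `|u|`
up to a logarithm (Lemma 4.1: "`|r(u,v) − (v − u)| = O(log r)`"). This file packages that once:

* `GoodRegion M r v₁ v₂ U₀ A` — the quantitative hypotheses on `U₀` (`U₀ ≤ −3`; `r(u, v₁) ≥ 4M`;
  `r(u, v) ≥ |u|/2` for `v ≥ v₁`; `|r(u, v) − |u|| ≤ A log|u|` on the strip; `A log|u| ≤ |u|/2`), and
  `exists_goodRegion` — they hold for every EF area radius (`M > 0`) once `U₀` is negative enough
  (from `x − 2M log x ≤ efAreaRadius M x ≤ max x (2M + 1)` and the structure theorem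
  `r(u,v) = efAreaRadius M (v − u − c)`);
* the integration rules of the decay bootstrap: `∫_{−∞}^{u} |u'|^{−k} du' = |u|^{1−k}/(k − 1)`,
  `∫_{−∞}^{u} r(u',v)^{−k} du' ≤ 2 r(u,v)^{1−k}/(k − 1)`, `∫_{v₂}^{v} r(u,v')^{−k} dv' ≤ 2 r(u,v₂)^{1−k}/(k − 1)`
  (`k ≥ 2`; from `∂ᵤr = −(1 − 2M/r)`, `∂ᵥr = 1 − 2M/r ≥ 1/2`), the resulting "`U`-rule" and
  "`R`-rule" for `∫_{−∞}^{u}` of integrands bounded by `C |u'|^{−a} r^{−b}`, and the strip comparison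
  `|r(u,v)^{−k} − |u|^{−k}| ≤ C log|u| / |u|^{k+1}`.

Elementary real analysis; [folklore] throughout, the setting being Kehrberger's §4.1 and Lemma 4.1.
-/

noncomputable section

open Set Filter Topology MeasureTheory intervalIntegral Function Asymptotics

namespace Literature.Barriers.FinalStateConjecture

/-! ### The region hypotheses -/

/-- **The early-time region hypotheses.** For `u ≤ U₀`: `U₀ ≤ −3` (so `|u| ≥ 3`, `log|u| ≥ 1`),
`r(u, v₁) ≥ 4M` (so `1 − 2M/r ≥ 1/2` for `v ≥ v₁`), `r(u, v) ≥ |u|/2` for `v ≥ v₁`, and on the data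
strip `v ∈ [v₁, v₂]`: `|r(u, v) − |u|| ≤ A log|u|` with `A log|u| ≤ |u|/2` (Kehrberger, Lemma 4.1:
"`|r(u,v) − (v − u)| = O(log r)`", and §4.1: "for sufficiently large negative values of `U₀`").
[cite: Kehrberger2022AHP, Lemma 4.1 and §4.1] -/
structure GoodRegion (M : ℝ) (r : ℝ → ℝ → ℝ) (v₁ v₂ U₀ A : ℝ) : Prop where
  U₀_le : U₀ ≤ -3
  A_nonneg : 0 ≤ A
  radius_ge : ∀ u, u ≤ U₀ → 4 * M ≤ r u v₁
  half_le : ∀ u, u ≤ U₀ → ∀ v, v₁ ≤ v → -u / 2 ≤ r u v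
  strip : ∀ u, u ≤ U₀ → ∀ v ∈ Icc v₁ v₂, |r u v - -u| ≤ A * Real.log (-u)
  log_small : ∀ u, u ≤ U₀ → A * Real.log (-u) ≤ -u / 2

namespace GoodRegion

variable {M : ℝ} {r : ℝ → ℝ → ℝ} {v₁ v₂ U₀ A : ℝ} (hR : GoodRegion M r v₁ v₂ U₀ A)
include hR

/-- `|u| ≥ 3` in the region. [folklore] -/
lemma three_le {u : ℝ} (hu : u ≤ U₀) : 3 ≤ -u := by linarith [hR.U₀_le]

/-- `|u| > 0` in the region. [folklore] -/
lemma neg_pos {u : ℝ} (hu : u ≤ U₀) : 0 < -u := by linarith [hR.U₀_le]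

/-- `|u| ≥ 1` in the region. [folklore] -/
lemma one_le {u : ℝ} (hu : u ≤ U₀) : 1 ≤ -u := by linarith [hR.U₀_le]

/-- `log|u| ≥ 1` in the region. [folklore] -/
lemma one_le_log {u : ℝ} (hu : u ≤ U₀) : 1 ≤ Real.log (-u) := by
  rw [← Real.log_exp 1]
  refine Real.log_le_log (Real.exp_pos 1) ?_
  have := Real.exp_one_lt_three
  linarith [hR.three_le hu]

/-- `log|u| ≥ 0` in the region. [folklore] -/
lemma log_nonneg {u : ℝ} (hu : u ≤ U₀) : 0 ≤ Real.log (-u) := le_trans zero_le_one (hR.one_le_log hu)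

/-- `1/r ≤ 2/|u|` in the region (`v ≥ v₁`). [folklore] -/
lemma inv_radius_le (hr : IsEFAreaRadius M r) (hM : 0 < M) {u v : ℝ} (hu : u ≤ U₀) (hv : v₁ ≤ v) :
    (r u v)⁻¹ ≤ 2 / -u := by
  have h := hR.half_le u hu v hv
  have h0 : 0 < r u v := hr.pos hM.le u v
  have hu0 := hR.neg_pos hu
  rw [inv_eq_one_div, div_le_div_iff₀ h0 hu0]
  linarith

/-- `1/r^k ≤ 2^k/|u|^k` in the region (`v ≥ v₁`). [folklore] -/
lemma inv_radius_pow_le (hr : IsEFAreaRadius M r) (hM : 0 < M) {u v : ℝ} (hu : u ≤ U₀) (hv : v₁ ≤ v)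
    (k : ℕ) : (r u v ^ k)⁻¹ ≤ 2 ^ k / (-u) ^ k := by
  have h := hR.half_le u hu v hv
  have hu0 := hR.neg_pos hu
  have h1 : (-u / 2) ^ k ≤ r u v ^ k := pow_le_pow_left₀ (by positivity) h k
  rw [inv_eq_one_div, div_le_div_iff₀ (pow_pos (hr.pos hM.le u v) k) (pow_pos hu0 k)]
  calc 1 * (-u) ^ k = 2 ^ k * (-u / 2) ^ k := by rw [div_pow]; field_simp
    _ ≤ 2 ^ k * r u v ^ k := mul_le_mul_of_nonneg_left h1 (by positivity)

/-- `1 − 2M/r ≥ 1/2` in the region (`v ≥ v₁`, `M > 0`). [folklore] -/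
lemma factor_ge_half (hr : IsEFAreaRadius M r) (hM : 0 < M) {u v : ℝ} (hu : u ≤ U₀) (hv : v₁ ≤ v) :
    1 / 2 ≤ 1 - 2 * M / r u v := by
  have h4 : 4 * M ≤ r u v := (hR.radius_ge u hu).trans ((hr.strictMono_right hM u).monotone hv)
  have h0 : 0 < r u v := hr.pos hM.le u v
  have h1 : 2 * M / r u v ≤ 1 / 2 := by rw [div_le_iff₀ h0]; linarith
  linarith

/-- On the strip, `r ≤ 2|u|`. [folklore] -/
lemma radius_le_two_mul {u v : ℝ} (hu : u ≤ U₀) (hv : v ∈ Icc v₁ v₂) : r u v ≤ 2 * -u := by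
  have h := hR.strip u hu v hv
  have h2 := hR.log_small u hu
  have h0 := hR.neg_pos hu
  have := (abs_le.1 h).2
  linarith

end GoodRegion

/-! ### Existence of a good region -/

section Existence

variable {M : ℝ} {r : ℝ → ℝ → ℝ} (hr : IsEFAreaRadius M r) (hM : 0 < M)
include hr hM

omit hr in
/-- `7x/8 ≤ x − 2M log x` eventually. [folklore] -/
lemma eventually_le_sub_log : ∀ᶠ x : ℝ in atTop, 7 * x / 8 ≤ x - 2 * M * Real.log x := by
  have h := Real.isLittleO_log_id_atTop.bound (show (0 : ℝ) < 1 / (16 * M) by positivity)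
  filter_upwards [h, eventually_ge_atTop (1 : ℝ)] with x hx hx1
  simp only [id_eq, Real.norm_eq_abs, abs_of_nonneg (Real.log_nonneg hx1),
    abs_of_pos (show (0 : ℝ) < x by linarith)] at hx
  have : 2 * M * Real.log x ≤ 2 * M * (1 / (16 * M) * x) := mul_le_mul_of_nonneg_left hx (by positivity)
  have h2 : 2 * M * (1 / (16 * M) * x) = x / 8 := by field_simp; ring
  linarith

/-- **Good regions exist**: for every EF area radius (`M > 0`) and every `v₁ ≤ v₂` there are
`U₀ < −1` and `A ≥ 0` with `GoodRegion M r v₁ v₂ U₀ A`. [cite: Kehrberger2022AHP, Lemma 4.1 and §4.1] -/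
theorem exists_goodRegion (v₁ v₂ : ℝ) :
    ∃ U₀ A : ℝ, U₀ < -1 ∧ GoodRegion M r v₁ v₂ U₀ A := by
  obtain ⟨c, hc⟩ := hr.exists_eq_efAreaRadius hM
  set B : ℝ := |v₁ - c| + |v₂ - c| + 2 * M + 1 with hB
  have hB0 : 0 ≤ |v₁ - c| + |v₂ - c| := by positivity
  set A : ℝ := B + 4 * M with hA
  have hA0 : 0 ≤ A := by simp only [hA, hB]; positivity
  -- the five eventual properties as `u → -∞`
  have h1 : ∀ᶠ u : ℝ in atBot, u ≤ -3 := eventually_le_atBot _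
  have h2 : ∀ᶠ u : ℝ in atBot, 4 * M ≤ r u v₁ :=
    (hr.tendsto_atBot hM.le v₁).eventually (eventually_ge_atTop _)
  -- `x := v₁ - u - c → ∞`
  have hx : Tendsto (fun u : ℝ ↦ v₁ - u - c) atBot atTop := by
    have : Tendsto (fun u : ℝ ↦ (v₁ - c) + -u) atBot atTop :=
      tendsto_atTop_add_const_left _ _ tendsto_neg_atBot_atTop
    exact this.congr fun u ↦ by ring
  have h3 : ∀ᶠ u : ℝ in atBot, ∀ v, v₁ ≤ v → -u / 2 ≤ r u v := by
    have hq := hx.eventually (eventually_le_sub_log hM)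
    have hx1 := hx.eventually (eventually_ge_atTop (1 : ℝ))
    filter_upwards [hq, hx1, eventually_le_atBot (-(3 * |v₁ - c|))] with u hq hx1 hu3 v hv'
    have hlow := sub_log_le_efAreaRadius hM hx1
    have hmono : r u v₁ ≤ r u v := (hr.strictMono_right hM u).monotone hv'
    rw [hc u v₁] at hmono
    have habs : -|v₁ - c| ≤ v₁ - c := neg_abs_le _
    linarith [abs_nonneg (v₁ - c)]
  have h4 : ∀ᶠ u : ℝ in atBot, ∀ v ∈ Icc v₁ v₂, |r u v - -u| ≤ A * Real.log (-u) := by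
    filter_upwards [eventually_le_atBot (-(B + |v₁ - c| + |v₂ - c| + 3))] with u hu v hv
    have hu3 : 3 ≤ -u := by linarith [abs_nonneg (v₁ - c), abs_nonneg (v₂ - c)]
    have hlog1 : 1 ≤ Real.log (-u) := by
      rw [← Real.log_exp 1]
      exact Real.log_le_log (Real.exp_pos 1) (by linarith [Real.exp_one_lt_three])
    set x := v - u - c with hxdef
    have hxv : x - -u = v - c := by rw [hxdef]; ring
    have hvc : |v - c| ≤ |v₁ - c| + |v₂ - c| := by
      rw [abs_le]; constructor <;>
        linarith [hv.1, hv.2, neg_abs_le (v₁ - c), le_abs_self (v₂ - c), abs_nonneg (v₁ - c),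
          abs_nonneg (v₂ - c)]
    have hx1 : 2 * M + 1 ≤ x := by
      have := neg_abs_le (v - c); linarith
    have hx1' : 1 ≤ x := by linarith
    have hxle : x ≤ 2 * -u := by have := le_abs_self (v - c); linarith
    rw [hc u v, ← hxdef]
    have hup : efAreaRadius M x ≤ x := by
      have := efAreaRadius_le_max hM x
      rwa [max_eq_left (by linarith)] at this
    have hlow := sub_log_le_efAreaRadius hM hx1'
    have hlogx : Real.log x ≤ Real.log 2 + Real.log (-u) := by
      rw [← Real.log_mul (by norm_num) (by linarith)]
      exact Real.log_le_log (by linarith) hxle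
    have hlog2 : Real.log 2 ≤ 1 := by
      have := Real.log_two_lt_d9; linarith
    rw [abs_le]
    constructor
    · -- lower bound: `r - |u| ≥ (v - c) - 2M log x ≥ -B - 2M(1 + log|u|) ≥ -A log|u|`
      have : -(A * Real.log (-u)) ≤ (v - c) - 2 * M * Real.log x := by
        have h' : 2 * M * Real.log x ≤ 2 * M * (1 + Real.log (-u)) := by
          refine mul_le_mul_of_nonneg_left ?_ (by positivity); linarith
        have h'' : -(|v₁ - c| + |v₂ - c|) ≤ v - c := by linarith [neg_abs_le (v - c)]
        simp only [hA, hB]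
        nlinarith [hlog1, abs_nonneg (v₁ - c), abs_nonneg (v₂ - c), hM]
      linarith
    · -- upper bound: `r - |u| ≤ x - |u| = v - c ≤ B ≤ A log|u|`
      have : v - c ≤ A * Real.log (-u) := by
        have := le_abs_self (v - c)
        simp only [hA, hB]
        nlinarith [hlog1, abs_nonneg (v₁ - c), abs_nonneg (v₂ - c), hM]
      linarith
  have h5 : ∀ᶠ u : ℝ in atBot, A * Real.log (-u) ≤ -u / 2 := by
    have h := Real.isLittleO_log_id_atTop.bound (show (0 : ℝ) < 1 / (2 * (A + 1)) by positivity)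
    filter_upwards [tendsto_neg_atBot_atTop.eventually (h.and (eventually_ge_atTop (1 : ℝ)))] with u hu
    obtain ⟨hb, hu1⟩ := hu
    simp only [id_eq, Real.norm_eq_abs, abs_of_nonneg (Real.log_nonneg hu1),
      abs_of_pos (show (0 : ℝ) < -u by linarith)] at hb
    have : A * Real.log (-u) ≤ A * (1 / (2 * (A + 1)) * -u) := mul_le_mul_of_nonneg_left hb hA0
    have h2 : A * (1 / (2 * (A + 1)) * -u) ≤ -u / 2 := by
      rw [show A * (1 / (2 * (A + 1)) * -u) = (A / (A + 1)) * (-u / 2) by field_simp]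
      have hA1 : A / (A + 1) ≤ 1 := by rw [div_le_one (by linarith)]; linarith
      exact mul_le_of_le_one_left (by linarith) hA1
    linarith
  obtain ⟨U, hU⟩ := eventually_atBot.1 (h1.and (h2.and (h3.and (h4.and h5))))
  refine ⟨min U (-3), A, by norm_num, ?_⟩
  have hU' : ∀ u, u ≤ min U (-3) → u ≤ U := fun u hu ↦ hu.trans (min_le_left _ _)
  exact { U₀_le := min_le_right _ _
          A_nonneg := hA0
          radius_ge := fun u hu ↦ (hU u (hU' u hu)).2.1
          half_le := fun u hu ↦ (hU u (hU' u hu)).2.2.1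
          strip := fun u hu ↦ (hU u (hU' u hu)).2.2.2.1
          log_small := fun u hu ↦ (hU u (hU' u hu)).2.2.2.2 }

end Existence

/-! ### The integration rules -/

section Rules

variable {M : ℝ} {r : ℝ → ℝ → ℝ} {v₁ v₂ U₀ A : ℝ} (hr : IsEFAreaRadius M r) (hM : 0 < M)
  (hR : GoodRegion M r v₁ v₂ U₀ A)

/-- **`∫_{−∞}^{u} |u'|^{−(n+2)} du' = |u|^{−(n+1)}/(n+1)`** (`u < 0`), with integrability. [folklore] -/
theorem integral_Iic_inv_pow (n : ℕ) {u : ℝ} (hu : u < 0) :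
    IntegrableOn (fun u' ↦ ((-u') ^ (n + 2))⁻¹) (Iic u) ∧
      ∫ u' in Iic u, ((-u') ^ (n + 2))⁻¹ = (((n : ℝ) + 1) * (-u) ^ (n + 1))⁻¹ := by
  -- antiderivative `g(u') = ((n+1)(-u')^(n+1))⁻¹`
  have hderiv : ∀ x ∈ Iic u, HasDerivAt (fun u' : ℝ ↦ (((n : ℝ) + 1) * (-u') ^ (n + 1))⁻¹)
      (((-x) ^ (n + 2))⁻¹) x := by
    intro x hx
    have hx0 : 0 < -x := by linarith [mem_Iic.1 hx]
    have hc : HasDerivAt (fun u' : ℝ ↦ ((n : ℝ) + 1) * (-u') ^ (n + 1))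
        (((n : ℝ) + 1) * (((n + 1 : ℕ) : ℝ) * (-x) ^ (n + 1 - 1) * -1)) x :=
      ((hasDerivAt_neg x).pow (n + 1)).const_mul _
    have hne : ((n : ℝ) + 1) * (-x) ^ (n + 1) ≠ 0 := by positivity
    refine (hc.inv hne).congr_deriv ?_
    rw [Nat.add_sub_cancel]
    push_cast
    field_simp
    ring
  have hpos : ∀ x ∈ Iic u, 0 ≤ ((-x) ^ (n + 2))⁻¹ := fun x hx ↦ by
    have : 0 < -x := by linarith [mem_Iic.1 hx]
    positivity
  have hlim : Tendsto (fun u' : ℝ ↦ (((n : ℝ) + 1) * (-u') ^ (n + 1))⁻¹) atBot (𝓝 0) := by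
    have h1 : Tendsto (fun u' : ℝ ↦ ((n : ℝ) + 1) * (-u') ^ (n + 1)) atBot atTop :=
      Tendsto.const_mul_atTop (by positivity)
        ((tendsto_pow_atTop (by omega)).comp tendsto_neg_atBot_atTop)
    exact h1.inv_tendsto_atTop
  refine ⟨integrableOn_Iic_deriv_of_nonneg' hderiv hpos hlim, ?_⟩
  rw [integral_Iic_of_hasDerivAt_of_tendsto' hderiv (integrableOn_Iic_deriv_of_nonneg' hderiv hpos hlim) hlim]
  ring

include hr hM hR

/-- Along the ray `u' ≤ u` (`u ≤ U₀`, `v ≥ v₁`): `1 − 2M/r(u',v) ≥ 1/2`. [folklore] -/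
lemma factor_ge_half_of_le {u u' v : ℝ} (hu : u ≤ U₀) (hu' : u' ≤ u) (hv : v₁ ≤ v) :
    1 / 2 ≤ 1 - 2 * M / r u' v :=
  hR.factor_ge_half hr hM (hu'.trans hu) hv

/-- **`∫_{−∞}^{u} r(u',v)^{−(n+2)} du' ≤ 2 r(u,v)^{−(n+1)}/(n+1)`** in the region (compare with
`∂ᵤ [((n+1) r^{n+1})⁻¹] = (1 − 2M/r)/r^{n+2} ≥ r^{−(n+2)}/2`), with integrability. [folklore] -/
theorem integral_Iic_radius_inv_pow (n : ℕ) {u v : ℝ} (hu : u ≤ U₀) (hv : v₁ ≤ v) :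
    IntegrableOn (fun u' ↦ (r u' v ^ (n + 2))⁻¹) (Iic u) ∧
      ∫ u' in Iic u, (r u' v ^ (n + 2))⁻¹ ≤ 2 * (((n : ℝ) + 1) * r u v ^ (n + 1))⁻¹ := by
  set g : ℝ → ℝ := fun u' ↦ (((n : ℝ) + 1) * r u' v ^ (n + 1))⁻¹ with hg
  set g' : ℝ → ℝ := fun u' ↦ (1 - 2 * M / r u' v) / r u' v ^ (n + 2) with hg'
  have hderiv : ∀ x ∈ Iic u, HasDerivAt g (g' x) x := by
    intro x _
    have h0 : r x v ≠ 0 := (hr.pos hM.le x v).ne'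
    have hc : HasDerivAt (fun u' : ℝ ↦ ((n : ℝ) + 1) * r u' v ^ (n + 1))
        (((n : ℝ) + 1) * (((n + 1 : ℕ) : ℝ) * r x v ^ (n + 1 - 1) * -(1 - 2 * M / r x v))) x :=
      ((hr.2.2 x v).pow (n + 1)).const_mul _
    have hne : ((n : ℝ) + 1) * r x v ^ (n + 1) ≠ 0 := by
      have := hr.pos hM.le x v; positivity
    refine (hc.inv hne).congr_deriv ?_
    rw [Nat.add_sub_cancel]
    simp only [hg']
    push_cast
    field_simp
    ring
  have hpos : ∀ x ∈ Iic u, 0 ≤ g' x := fun x _ ↦ by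
    simp only [hg']
    exact div_nonneg (hr.factor_pos hM.le x v).le (pow_nonneg (hr.pos hM.le x v).le _)
  have hlim : Tendsto g atBot (𝓝 0) := by
    have h1 : Tendsto (fun u' : ℝ ↦ ((n : ℝ) + 1) * r u' v ^ (n + 1)) atBot atTop :=
      Tendsto.const_mul_atTop (by positivity)
        ((tendsto_pow_atTop (by omega)).comp (hr.tendsto_atBot hM.le v))
    exact h1.inv_tendsto_atTop
  have hint : IntegrableOn g' (Iic u) := integrableOn_Iic_deriv_of_nonneg' hderiv hpos hlim
  have hval : ∫ x in Iic u, g' x = g u - 0 := integral_Iic_of_hasDerivAt_of_tendsto' hderiv hint hlim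
  -- comparison `r^{-(n+2)} ≤ 2 g'`
  have hcmp : ∀ x ∈ Iic u, (r x v ^ (n + 2))⁻¹ ≤ 2 * g' x := by
    intro x hx
    have hD := factor_ge_half_of_le hr hM hR hu (mem_Iic.1 hx) hv
    have hp : 0 < r x v ^ (n + 2) := pow_pos (hr.pos hM.le x v) _
    simp only [hg']
    rw [inv_eq_one_div, mul_div_assoc', div_le_div_iff_of_pos_right hp]
    linarith
  have hc : Continuous fun u' ↦ (r u' v ^ (n + 2))⁻¹ :=
    ((continuous_slice_left (hr.contDiff_uncurry hM).continuous v).pow _).inv₀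
      fun u' ↦ pow_ne_zero _ (hr.pos hM.le u' v).ne'
  have hint2 : IntegrableOn (fun u' ↦ (r u' v ^ (n + 2))⁻¹) (Iic u) := by
    refine Integrable.mono' (hint.const_mul 2) hc.aestronglyMeasurable ?_
    refine (ae_restrict_iff' measurableSet_Iic).2 (Eventually.of_forall fun x hx ↦ ?_)
    rw [Real.norm_eq_abs, abs_of_pos (by have := hr.pos hM.le x v; positivity)]
    exact hcmp x hx
  refine ⟨hint2, ?_⟩
  calc ∫ u' in Iic u, (r u' v ^ (n + 2))⁻¹ ≤ ∫ u' in Iic u, 2 * g' u' :=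
        setIntegral_mono_on hint2 (hint.const_mul 2) measurableSet_Iic hcmp
    _ = 2 * (g u - 0) := by rw [MeasureTheory.integral_const_mul, hval]
    _ = 2 * (((n : ℝ) + 1) * r u v ^ (n + 1))⁻¹ := by simp [hg]

/-- **`∫_{v₂}^{v} r(u,v')^{−(n+2)} dv' ≤ 2 r(u,v₂)^{−(n+1)}/(n+1)`** in the region (`v ≥ v₂ ≥ v₁`).
[folklore] -/
theorem integral_right_radius_inv_pow (n : ℕ) {u v : ℝ} (hu : u ≤ U₀) (h12 : v₁ ≤ v₂) (hv : v₂ ≤ v) :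
    ∫ v' in v₂..v, (r u v' ^ (n + 2))⁻¹ ≤ 2 * (((n : ℝ) + 1) * r u v₂ ^ (n + 1))⁻¹ := by
  set g : ℝ → ℝ := fun v' ↦ -(((n : ℝ) + 1) * r u v' ^ (n + 1))⁻¹ with hg
  set g' : ℝ → ℝ := fun v' ↦ (1 - 2 * M / r u v') / r u v' ^ (n + 2) with hg'
  have hderiv : ∀ x : ℝ, HasDerivAt g (g' x) x := by
    intro x
    have h0 : r u x ≠ 0 := (hr.pos hM.le u x).ne'
    have hc : HasDerivAt (fun v' : ℝ ↦ ((n : ℝ) + 1) * r u v' ^ (n + 1))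
        (((n : ℝ) + 1) * (((n + 1 : ℕ) : ℝ) * r u x ^ (n + 1 - 1) * (1 - 2 * M / r u x))) x :=
      ((hr.2.1 u x).pow (n + 1)).const_mul _
    have hne : ((n : ℝ) + 1) * r u x ^ (n + 1) ≠ 0 := by
      have := hr.pos hM.le u x; positivity
    refine ((hc.inv hne).neg).congr_deriv ?_
    rw [Nat.add_sub_cancel]
    simp only [hg']
    push_cast
    field_simp
    ring
  have hcg' : Continuous g' := by
    have hc := hr.continuous_snd u
    simp only [hg']
    exact ((continuous_const.sub (continuous_const.div hc fun v' ↦ (hr.pos hM.le u v').ne')).div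
      (hc.pow _) fun v' ↦ pow_ne_zero _ (hr.pos hM.le u v').ne')
  have hc : Continuous fun v' ↦ (r u v' ^ (n + 2))⁻¹ :=
    ((hr.continuous_snd u).pow _).inv₀ fun v' ↦ pow_ne_zero _ (hr.pos hM.le u v').ne'
  have hcmp : ∀ x ∈ Icc v₂ v, (r u x ^ (n + 2))⁻¹ ≤ 2 * g' x := by
    intro x hx
    have hD := hR.factor_ge_half hr hM hu (h12.trans hx.1)
    have hp : 0 < r u x ^ (n + 2) := pow_pos (hr.pos hM.le u x) _
    simp only [hg']
    rw [inv_eq_one_div, mul_div_assoc', div_le_div_iff_of_pos_right hp]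
    linarith
  calc ∫ v' in v₂..v, (r u v' ^ (n + 2))⁻¹ ≤ ∫ v' in v₂..v, 2 * g' v' :=
        intervalIntegral.integral_mono_on hv (hc.intervalIntegrable _ _)
          ((hcg'.const_mul 2).intervalIntegrable _ _) hcmp
    _ = 2 * (g v - g v₂) := by
        rw [intervalIntegral.integral_const_mul,
          intervalIntegral.integral_eq_sub_of_hasDerivAt (fun x _ ↦ hderiv x) (hcg'.intervalIntegrable _ _)]
    _ ≤ 2 * (((n : ℝ) + 1) * r u v₂ ^ (n + 1))⁻¹ := by
        have : 0 ≤ (((n : ℝ) + 1) * r u v ^ (n + 1))⁻¹ := by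
          have := hr.pos hM.le u v; positivity
        simp only [hg]
        linarith

omit hR in
/-- `r(u', v) ≥ r(u, v)` for `u' ≤ u`, as an inequality of inverse powers. [folklore] -/
lemma inv_radius_pow_le_of_le {u u' v : ℝ} (hu' : u' ≤ u) (k : ℕ) :
    (r u' v ^ k)⁻¹ ≤ (r u v ^ k)⁻¹ := by
  have h1 : r u v ≤ r u' v := (hr.strictAnti_left hM v).antitone hu'
  have h0 : 0 < r u v := hr.pos hM.le u v
  exact inv_anti₀ (pow_pos h0 k) (pow_le_pow_left₀ h0.le h1 k)

omit hr hM hR in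
/-- `|u'| ≥ |u|` for `u' ≤ u < 0`, as an inequality of inverse powers. [folklore] -/
lemma inv_neg_pow_le_of_le {u u' : ℝ} (hu : u < 0) (hu' : u' ≤ u) (k : ℕ) :
    ((-u') ^ k)⁻¹ ≤ ((-u) ^ k)⁻¹ :=
  inv_anti₀ (pow_pos (by linarith) k) (pow_le_pow_left₀ (by linarith) (by linarith) k)

/-- **The `U`-rule**: if `|h(u', v)| ≤ C |u'|^{−(a+2)} r(u',v)^{−b}` along the ray `u' ≤ u`, then
`|∫_{−∞}^{u} h(u',v) du'| ≤ C r(u,v)^{−b} |u|^{−(a+1)}/(a+1)`. [folklore] -/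
theorem abs_uPrimitive_le_U {h : ℝ → ℝ → ℝ} {C : ℝ} {a b : ℕ}
    {u v : ℝ} (hu : u ≤ U₀)
    (hB : ∀ u', u' ≤ u → |h u' v| ≤ C * (((-u') ^ (a + 2))⁻¹ * (r u' v ^ b)⁻¹)) :
    |uPrimitive h u v| ≤ C * ((((a : ℝ) + 1) * (-u) ^ (a + 1))⁻¹ * (r u v ^ b)⁻¹) := by
  have hu0 : u < 0 := by linarith [hR.U₀_le]
  have hC : 0 ≤ C := by
    have h1 := hB u le_rfl
    have h2 : 0 < ((-u) ^ (a + 2))⁻¹ * (r u v ^ b)⁻¹ := by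
      have := hr.pos hM.le u v
      have : 0 < -u := by linarith
      positivity
    nlinarith [abs_nonneg (h u v)]
  obtain ⟨hint, hval⟩ := integral_Iic_inv_pow a hu0
  -- majorant `C (r u v ^ b)⁻¹ |u'|^{-(a+2)}`
  have hmaj : ∀ u', u' ≤ u → |h u' v| ≤ C * (r u v ^ b)⁻¹ * ((-u') ^ (a + 2))⁻¹ := by
    intro u' hu'
    refine (hB u' hu').trans ?_
    rw [mul_assoc, mul_comm ((r u v ^ b)⁻¹)]
    refine mul_le_mul_of_nonneg_left (mul_le_mul_of_nonneg_left
      (inv_radius_pow_le_of_le hr hM hu' b) ?_) hC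
    have : 0 < -u' := by linarith
    positivity
  have hintC : IntegrableOn (fun u' ↦ C * (r u v ^ b)⁻¹ * ((-u') ^ (a + 2))⁻¹) (Iic u) :=
    hint.const_mul _
  rw [uPrimitive_apply, ← Real.norm_eq_abs]
  refine (norm_integral_le_of_norm_le hintC ((ae_restrict_iff' measurableSet_Iic).2
    (Eventually.of_forall fun u' hu' ↦ by rw [Real.norm_eq_abs]; exact hmaj u' hu'))).trans ?_
  rw [MeasureTheory.integral_const_mul, hval]
  ring_nf
  rfl

/-- **The `R`-rule**: if `|h(u', v)| ≤ C |u'|^{−a} r(u',v)^{−(b+2)}` along the ray `u' ≤ u`, then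
`|∫_{−∞}^{u} h(u',v) du'| ≤ 2C |u|^{−a} r(u,v)^{−(b+1)}/(b+1)` (`v ≥ v₁`). [folklore] -/
theorem abs_uPrimitive_le_R {h : ℝ → ℝ → ℝ} {C : ℝ} {a b : ℕ}
    {u v : ℝ} (hu : u ≤ U₀) (hv : v₁ ≤ v)
    (hB : ∀ u', u' ≤ u → |h u' v| ≤ C * (((-u') ^ a)⁻¹ * (r u' v ^ (b + 2))⁻¹)) :
    |uPrimitive h u v| ≤ 2 * C * (((-u) ^ a)⁻¹ * ((((b : ℝ) + 1)) * r u v ^ (b + 1))⁻¹) := by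
  have hu0 : u < 0 := by linarith [hR.U₀_le]
  have hC : 0 ≤ C := by
    have h1 := hB u le_rfl
    have h2 : 0 < ((-u) ^ a)⁻¹ * (r u v ^ (b + 2))⁻¹ := by
      have := hr.pos hM.le u v
      have : 0 < -u := by linarith
      positivity
    nlinarith [abs_nonneg (h u v)]
  obtain ⟨hint, hval⟩ := integral_Iic_radius_inv_pow hr hM hR b hu hv
  have hmaj : ∀ u', u' ≤ u → |h u' v| ≤ C * ((-u) ^ a)⁻¹ * (r u' v ^ (b + 2))⁻¹ := by
    intro u' hu'
    refine (hB u' hu').trans ?_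
    rw [mul_assoc]
    refine mul_le_mul_of_nonneg_left (mul_le_mul_of_nonneg_right
      (inv_neg_pow_le_of_le hu0 hu' a) ?_) hC
    have := hr.pos hM.le u' v; positivity
  have hintC : IntegrableOn (fun u' ↦ C * ((-u) ^ a)⁻¹ * (r u' v ^ (b + 2))⁻¹) (Iic u) :=
    hint.const_mul _
  rw [uPrimitive_apply, ← Real.norm_eq_abs]
  refine (norm_integral_le_of_norm_le hintC ((ae_restrict_iff' measurableSet_Iic).2
    (Eventually.of_forall fun u' hu' ↦ by rw [Real.norm_eq_abs]; exact hmaj u' hu'))).trans ?_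
  rw [MeasureTheory.integral_const_mul]
  have hpos : 0 ≤ C * ((-u) ^ a)⁻¹ := by
    have : 0 < -u := by linarith
    positivity
  calc C * ((-u) ^ a)⁻¹ * ∫ u' in Iic u, (r u' v ^ (b + 2))⁻¹
      ≤ C * ((-u) ^ a)⁻¹ * (2 * (((b : ℝ) + 1) * r u v ^ (b + 1))⁻¹) :=
        mul_le_mul_of_nonneg_left hval hpos
    _ = 2 * C * (((-u) ^ a)⁻¹ * (((b : ℝ) + 1) * r u v ^ (b + 1))⁻¹) := by ring

/-- **The outgoing rule**: if `|h(u, v')| ≤ C |u|^{−a} r(u,v')^{−(b+2)}` on `[v₂, v]`, then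
`|∫_{v₂}^{v} h(u,v') dv'| ≤ 2C |u|^{−a} r(u,v₂)^{−(b+1)}/(b+1)`. [folklore] -/
theorem abs_integral_right_le {h : ℝ → ℝ → ℝ} {C : ℝ} {a b : ℕ}
    {u v : ℝ} (hu : u ≤ U₀) (h12 : v₁ ≤ v₂) (hv : v₂ ≤ v)
    (hB : ∀ v' ∈ Icc v₂ v, |h u v'| ≤ C * (((-u) ^ a)⁻¹ * (r u v' ^ (b + 2))⁻¹)) :
    |∫ v' in v₂..v, h u v'| ≤ 2 * C * (((-u) ^ a)⁻¹ * (((b : ℝ) + 1) * r u v₂ ^ (b + 1))⁻¹) := by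
  have hu0 : u < 0 := by linarith [hR.U₀_le]
  have hC : 0 ≤ C := by
    have h1 := hB v₂ ⟨le_rfl, hv⟩
    have h2 : 0 < ((-u) ^ a)⁻¹ * (r u v₂ ^ (b + 2))⁻¹ := by
      have := hr.pos hM.le u v₂
      have : 0 < -u := by linarith
      positivity
    nlinarith [abs_nonneg (h u v₂)]
  have hcb : Continuous fun v' ↦ C * (((-u) ^ a)⁻¹ * (r u v' ^ (b + 2))⁻¹) :=
    continuous_const.mul (continuous_const.mul (((hr.continuous_snd u).pow _).inv₀
      fun v' ↦ pow_ne_zero _ (hr.pos hM.le u v').ne'))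
  have h := intervalIntegral.norm_integral_le_of_norm_le (μ := volume) hv
    (f := fun v' ↦ h u v') (g := fun v' ↦ C * (((-u) ^ a)⁻¹ * (r u v' ^ (b + 2))⁻¹))
    (Eventually.of_forall fun v' hv' ↦ by
      rw [Real.norm_eq_abs]; exact hB v' ⟨hv'.1.le, hv'.2⟩) (hcb.intervalIntegrable _ _)
  rw [Real.norm_eq_abs] at h
  refine h.trans ?_
  rw [intervalIntegral.integral_const_mul, intervalIntegral.integral_const_mul]
  have hpos : 0 ≤ C * ((-u) ^ a)⁻¹ := by
    have : 0 < -u := by linarith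
    positivity
  calc C * (((-u) ^ a)⁻¹ * ∫ v' in v₂..v, (r u v' ^ (b + 2))⁻¹)
      = C * ((-u) ^ a)⁻¹ * ∫ v' in v₂..v, (r u v' ^ (b + 2))⁻¹ := by ring
    _ ≤ C * ((-u) ^ a)⁻¹ * (2 * (((b : ℝ) + 1) * r u v₂ ^ (b + 1))⁻¹) :=
        mul_le_mul_of_nonneg_left (integral_right_radius_inv_pow hr hM hR b hu h12 hv) hpos
    _ = 2 * C * (((-u) ^ a)⁻¹ * (((b : ℝ) + 1) * r u v₂ ^ (b + 1))⁻¹) := by ring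

/-- **The strip comparison**: on `v ∈ [v₁, v₂]`,
`|r(u,v)^{−k} − |u|^{−k}| ≤ k 4^k A log|u| / |u|^{k+1}`. [cite: Kehrberger2022AHP, Lemma 4.1] -/
theorem abs_inv_radius_pow_sub_le (k : ℕ) {u v : ℝ} (hu : u ≤ U₀) (hv : v ∈ Icc v₁ v₂) :
    |(r u v ^ k)⁻¹ - ((-u) ^ k)⁻¹| ≤ k * 4 ^ k * A * Real.log (-u) / (-u) ^ (k + 1) := by
  have hu0 : 0 < -u := hR.neg_pos hu
  have hr0 : 0 < r u v := hr.pos hM.le u v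
  have hA := hR.A_nonneg
  have hlog := hR.log_nonneg hu
  rcases Nat.eq_zero_or_pos k with hk | hk
  · subst hk; simp
  obtain ⟨m, rfl⟩ : ∃ m, k = m + 1 := ⟨k - 1, by omega⟩
  set t : ℝ := -u with ht
  have htne : t ≠ 0 := hu0.ne'
  -- `|1/r^k - 1/t^k| = |t^k - r^k|/(r^k t^k)`
  have heq : (r u v ^ (m + 1))⁻¹ - (t ^ (m + 1))⁻¹ =
      (t ^ (m + 1) - r u v ^ (m + 1)) / (r u v ^ (m + 1) * t ^ (m + 1)) := by
    field_simp
  rw [heq, abs_div, abs_of_pos (by positivity : 0 < r u v ^ (m + 1) * t ^ (m + 1)),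
    div_le_div_iff₀ (by positivity) (by positivity)]
  have hnum : |t ^ (m + 1) - r u v ^ (m + 1)| ≤ A * Real.log t * (m + 1) * (2 * t) ^ m := by
    have h := abs_pow_sub_pow_le (a := t) (b := r u v) (n := m + 1)
    rw [Nat.add_sub_cancel] at h
    refine h.trans ?_
    have h1 : |t - r u v| ≤ A * Real.log t := by
      rw [abs_sub_comm]; exact hR.strip u hu v hv
    have h2 : max |t| |r u v| ≤ 2 * t := by
      rw [abs_of_pos hu0, abs_of_pos hr0]
      exact max_le (by linarith) (hR.radius_le_two_mul hu hv)
    push_cast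
    gcongr
  have hden : (t / 2) ^ (m + 1) * t ^ (m + 1) ≤ r u v ^ (m + 1) * t ^ (m + 1) :=
    mul_le_mul_of_nonneg_right (pow_le_pow_left₀ (by positivity) (hR.half_le u hu v hv.1) _)
      (by positivity)
  have hRHS0 : 0 ≤ ((m + 1 : ℕ) : ℝ) * 4 ^ (m + 1) * A * Real.log t := by positivity
  have key : A * Real.log t * (m + 1) * (2 * t) ^ m * t ^ (m + 1 + 1) * 2 =
      ((m + 1 : ℕ) : ℝ) * 4 ^ (m + 1) * A * Real.log t * ((t / 2) ^ (m + 1) * t ^ (m + 1)) := by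
    push_cast
    rw [show (4 : ℝ) = 2 ^ 2 by norm_num, ← pow_mul, mul_pow, div_pow]
    field_simp
    ring
  have hN0 : 0 ≤ A * Real.log t * (m + 1) * (2 * t) ^ m * t ^ (m + 1 + 1) := by positivity
  calc |t ^ (m + 1) - r u v ^ (m + 1)| * t ^ (m + 1 + 1)
      ≤ A * Real.log t * (m + 1) * (2 * t) ^ m * t ^ (m + 1 + 1) :=
        mul_le_mul_of_nonneg_right hnum (by positivity)
    _ ≤ ((m + 1 : ℕ) : ℝ) * 4 ^ (m + 1) * A * Real.log t * ((t / 2) ^ (m + 1) * t ^ (m + 1)) := by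
        linarith
    _ ≤ ((m + 1 : ℕ) : ℝ) * 4 ^ (m + 1) * A * Real.log t * (r u v ^ (m + 1) * t ^ (m + 1)) :=
        mul_le_mul_of_nonneg_left hden hRHS0

end Rules

end Literature.Barriers.FinalStateConjecture

end
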